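import Literature.AlgebraicGeometry.HodgeTheory.SemiregularityHigherSigma
import Literature.AlgebraicGeometry.HodgeTheory.AtiyahClassCech
import Literature.AlgebraicGeometry.Modules.SheafHomFrames
import HarnessLib

/-!
# The higher Atiyah steps as Čech cocycles: frame splittings of the `Ωʲ`-twisted jet sequence

For a commutative ring `S`, an `S`-scheme `X : Over (Spec S)`, an `𝒪_X`-module `E` and `j : ℕ`, the tree's
`HodgeTheory/SemiregularityHigherSigma.lean` constructs the `Ωʲ`-twisted jet module `Pʲ(E) = twistJetModule E j`
(pairs `(φ, ψ)`, `φ ∈ E ⊗ Ωʲ`, `ψ ∈ E ⊗ Ωʲ⁺¹`, twisted action `a • (φ, ψ) = (a φ, a ψ + da ∧ φ)`), the short exact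
sequence `0 → E ⊗ Ωʲ⁺¹ → Pʲ(E) → E ⊗ Ωʲ → 0` and its class `at_j(E) = atiyahClassStep E j ∈ Ext¹(E ⊗ Ωʲ, E ⊗ Ωʲ⁺¹)`
(construction: tree, `SemiregularityHigherSigma`; for `E` finite locally free the class is `(At_E ⊗ 1_{Ωʲ})` followed
by `∧`, cf. [BuchweitzFlenner2003, Def. 3.4 / Thm. 3.10] for `At` and its exterior powers — BF's own model of `At` is
the commutator `[∂, ∇]` with the trivial connection `∇` of a local frame —; `j = 0`: [Atiyah1957, §4]). Here
`E ⊗ Ωʲ` is the tree's model `twistHodge E j = 𝓗om(E^∨, Ωʲ)`.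

This file gives the `Ext`-free (Čech) description of `at_j(E)` for `j ≥ 1`, exactly as
`HodgeTheory/AtiyahClassCech.lean` does for `j = 0`, WITHOUT any exterior derivative on `j`-forms: over an open
`W` carrying a frame `e : 𝒪^I ≅ E|_W` of `E` AND a frame `w : 𝒪^K ≅ Ωʲ|_W` of the Hodge sheaf (a "bi-frame"; for
`X/S` smooth `Ωʲ` is finite locally free — here this is a HYPOTHESIS carried by the frames, the named fact
`Motives.hasRank_hodgeSheaf_choose` is not used), `E ⊗ Ωʲ|_W` is free on the product basis `e_i ⊗ ω_K`
(`Modules.twistFrame e w`, `Modules/SheafHomFrames.lean`; [Kodaira2005, §3.2 (c), (3.52)–(3.53)]: the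
`e_α ⊗ f_β` form a basis of `F ⊗ G` over `U_j`, with Kronecker-product transition functions), and

* `frameTwistJetSection E j e w : (E ⊗ Ωʲ)|_W → Pʲ(E)|_W`, `e_i ⊗ ω_K ↦ (e_i ⊗ ω_K, 0)` — the `𝒪`-linear
  section of `twistJetπ` defined by FREENESS (the trivial connection of the bi-frame composed with `∧`); on
  sections `s(Σ f_{iK} e_i ⊗ ω_K) = (Σ f_{iK} e_i ⊗ ω_K, Σ df_{iK} ∧ (e_i ⊗ ω_K))` (`appLE_frameTwistJetSection`):
  "`d` on the coefficient FUNCTIONS only" (`Motives.dSection`), no `dω_K`;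
* `frameTwistJetSplitting`, `frameTwistJetRetraction` (`r(φ, ψ) = ψ - Σ df_{iK} ∧ (e_i ⊗ ω_K)`);
* for a **bi-framing** `𝔣 = (U_a, e_a, w_a)` of `E` and `Ωʲ` on a common cover (`BiFraming`; one exists as soon
  as `E` and `Ωʲ` are finite locally free, `BiFraming.ofIsFiniteLocallyFree`, and it covers `X`), the difference
  cocycle **`atiyahStepCocycle E j 𝔣`** of these splittings (a Čech `1`-cocycle of local homomorphisms
  `E ⊗ Ωʲ → E ⊗ Ωʲ⁺¹`), `dFamily_atiyahStepCocycle`, its values (`appLE_atiyahStepCocycle`), and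
  **`atiyahClassStep_eq_classOf`**: `at_j(E) = Cech.classOf (atiyahStepCocycle E j 𝔣)`
  (`Modules/CechClassOfLocallySplit.lean`);
* the cocycle on basis sections: `a_{ab}(b^b_{lL}) = Σ_{iK} d(T^{⊗}_{ab})_{(iK),(lL)} ∧ b^a_{iK}`
  (`appLE_atiyahStepCocycle_basisSection`) with `T^{⊗}_{ab} = T(e_a, e_b) ⊗ T(w_a, w_b)` the Kronecker product of
  the transition matrices (`transition_twistFrame`), whence the **two-term formula**
  `a_{ab}(e^b_l ⊗ ω^b_L) = Σ_i dT_{il} ∧ (e^a_i ⊗ ω^b_L) + Σ_K dR_{KL} ∧ (e^b_l ⊗ ω^a_K)`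
  (`appLE_atiyahStepCocycle_basisSection_eq_add`): the Atiyah cocycle `{dT}` of `E` wedged on the form part, plus
  `1_E ⊗` (the cocycle of `Pʲ(𝒪_X)` in the coframes `w`, which an exterior derivative on `Ωʲ` would split globally
  — it is a coboundary — but which is not zero as a cochain and need not be: it is the same for `E` and for any
  twist of `E` framed compatibly).

Everything is proved; no named facts. Consumers: the level-`j` Leibniz rule for `at_j` along the cocycle twist
`E ↦ E ⊗ M` (venture HSemireg, rows `q ≥ 2` of the re-expansion of `σ_q`), and block-matrix computations of
`σ_q = Tr(– · at_{q-1} ⋯ at_0)` on Čech cocycles.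

## References

* R.-O. Buchweitz, H. Flenner, *A semiregularity map for modules and applications to deformations*, Compositio
  Math. 137 (2003): §3.1 "Atiyah classes via connections", Def. 3.4 (the Atiyah class as the class of `[∂, ∇]`,
  `∇` a connection on a locally free resolution; the class of `[∂, ∇]^k` is the `k`-th power), Thm. 3.10
  (`At^k(ℱ) ∈ Ext^k_X(ℱ, ℱ ⊗ Λ^k 𝕃_{X/Y})`), §4 Def. 4.1 (`σ = Tr(∗ · exp(-At))`). [BuchweitzFlenner2003]
* M. F. Atiyah, *Complex analytic connections in fibre bundles*, Trans. AMS 85 (1957), §4 (the obstruction `b(E)`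
  as a Čech cocycle in transition matrices, Prop. 12: `b(L) = {-d log g_ij}`). [Atiyah1957]
* K. Kodaira, *Complex Manifolds and Deformation of Complex Structures* (2005), §3.2 (c) (p. 104–105):
  the basis `e_α ⊗ f_β` of `F ⊗ G` over `U_j` and the Kronecker-product transition functions (3.53). [Kodaira2005]
* R. Hartshorne, *Algebraic Geometry* (1977), II Ex. 5.1 (b), III.4. [Hartshorne1977]
-/

set_option backward.isDefEq.respectTransparency false

noncomputable section

universe u

open CategoryTheory CategoryTheory.Abelian AlgebraicGeometry Opposite TopologicalSpace Limits

namespace Literature.AlgebraicGeometry.HodgeTheory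

open Literature.AlgebraicGeometry.Modules Literature.AlgebraicGeometry.Motives
  Literature.Algebra.Homology

open scoped Classical

variable {S : Type u} [CommRing S] {X : Over (Spec (CommRingCat.of S))} (E : X.left.Modules) (j : ℕ)
  {W V : X.left.Opens} {I K : Type u}

/-! ### Simple tensors `s ⊗ ω ∈ Γ(E ⊗ Ωʲ, V)` and the Kronecker transition matrix -/

section SimpleTensor

variable {E j}

/-- **The simple tensor** `s ⊗ ω : E^∨|_V → Ωʲ|_V`, `μ ↦ μ(s) ω`, of sections `s ∈ Γ(E, V)`, `ω ∈ Γ(Ωʲ, V)`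
in the model `E ⊗ Ωʲ = 𝓗om(E^∨, Ωʲ)`; the product basis of a bi-frame is `e_i ⊗ ω_K = twistBasis`
(`tensorSection_basisSection`). [cite: Kodaira2005, §3.2 (c) (3.52)] -/
def tensorSection (s : Γ(E, V)) (ω : Γ(hodgeSheaf X j, V)) : (dual E).over V ⟶ (hodgeSheaf X j).over V :=
  evalAt (M := unitModule X.left) s ≫ smulSection ω

/-- `e_i ⊗ ω_K` is the product basis section `twistBasis e w (i, K)`. [cite: Kodaira2005, §3.2 (c)] -/
lemma tensorSection_basisSection (e : SheafOfModules.free I ≅ E.over W)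
    (w : SheafOfModules.free K ≅ (hodgeSheaf X j).over W) (ik : I × K) :
    tensorSection (basisSection e ik.1) (basisSection w ik.2) = twistBasis e w ik := rfl

/-- `s ⊗ ω` is additive in `ω`. [cite: Kodaira2005, §3.2 (c)] -/
lemma tensorSection_add_right (s : Γ(E, V)) (ω ω' : Γ(hodgeSheaf X j, V)) :
    tensorSection s (ω + ω') = tensorSection s ω + tensorSection s ω' := by
  refine hom_ext_of_appLE fun V' k μ => ?_
  rw [appLE_add, tensorSection, tensorSection, tensorSection, appLE_comp, appLE_comp, appLE_comp,
    appLE_smulSection, appLE_smulSection, appLE_smulSection, map_add, smul_add]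

/-- `s ⊗ (a ω) = a (s ⊗ ω)`. [cite: Kodaira2005, §3.2 (c)] -/
lemma tensorSection_smul_right (s : Γ(E, V)) (a : Γ(X.left, V)) (ω : Γ(hodgeSheaf X j, V)) :
    tensorSection s (a • ω) = a • tensorSection s ω := by
  refine hom_ext_of_appLE fun V' k μ => ?_
  rw [appLE_smul, tensorSection, tensorSection, appLE_comp, appLE_comp, appLE_smulSection,
    appLE_smulSection, Scheme.Modules.map_smul, smul_smul, smul_smul, mul_comm]

/-- `s ⊗ ω` is additive in `s`. [cite: Kodaira2005, §3.2 (c)] -/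
lemma tensorSection_add_left (s s' : Γ(E, V)) (ω : Γ(hodgeSheaf X j, V)) :
    tensorSection (s + s') ω = tensorSection s ω + tensorSection s' ω := by
  rw [tensorSection, evalAt_add, Preadditive.add_comp]
  rfl

/-- `(a s) ⊗ ω = a (s ⊗ ω)`. [cite: Kodaira2005, §3.2 (c)] -/
lemma tensorSection_smul_left (a : Γ(X.left, V)) (s : Γ(E, V)) (ω : Γ(hodgeSheaf X j, V)) :
    tensorSection (a • s) ω = a • tensorSection s ω := by
  refine hom_ext_of_appLE fun V' k μ => ?_
  rw [appLE_smul, tensorSection, tensorSection, appLE_comp, appLE_comp, appLE_evalAt, appLE_evalAt,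
    appLE_smulSection, appLE_smulSection, Scheme.Modules.map_smul, appLE_smul_right]
  change ((X.left.presheaf.map k.op a) * _) • _ = _
  rw [mul_smul]

/-- `D(a, –) = da ∧ –` is additive on finite sums. [cite: Kodaira2005, §3.2 (c)] -/
private lemma wedgeD_sum_right {ι' : Type*} (t : Finset ι') (a : Γ(X.left, V))
    (φ : ι' → ((dual E).over V ⟶ (hodgeSheaf X j).over V)) :
    wedgeD E j V a (∑ i ∈ t, φ i) = ∑ i ∈ t, wedgeD E j V a (φ i) :=
  map_sum (⟨⟨wedgeD E j V a, wedgeD_zero_right E j a⟩, wedgeD_add_right E j a⟩ :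
    ((dual E).over V ⟶ (hodgeSheaf X j).over V) →+ ((dual E).over V ⟶ (hodgeSheaf X (j + 1)).over V)) φ t

/-- Restriction of a simple tensor: `(s ⊗ ω)|_{V'} = s|_{V'} ⊗ ω|_{V'}`. [cite: Kodaira2005, §3.2 (c)] -/
lemma restrictHom_tensorSection {V' : X.left.Opens} (k : V' ⟶ V) (s : Γ(E, V)) (ω : Γ(hodgeSheaf X j, V)) :
    restrictHom k (tensorSection s ω) =
      tensorSection (E.presheaf.map k.op s) ((hodgeSheaf X j).presheaf.map k.op ω) := by
  refine hom_ext_of_appLE fun V'' l μ => ?_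
  rw [appLE_restrictHom, tensorSection, tensorSection, appLE_comp, appLE_comp, appLE_evalAt, appLE_evalAt,
    appLE_smulSection, appLE_smulSection, presheaf_map_map, presheaf_map_map]

variable [Fintype I] [Fintype K]

/-- **Mixed expansions**: `Σ_K R_{KL} (e_i ⊗ ω_K)| = e_i| ⊗ (Σ_K R_{KL} ω_K|)`, i.e. a sum of product basis
sections with coefficients in the form index is a simple tensor. [cite: Kodaira2005, §3.2 (c)] -/
lemma sum_smul_tensorSection_right (k : V ⟶ W) (s : Γ(E, V)) (w : SheafOfModules.free K ≅ (hodgeSheaf X j).over W)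
    (c : K → Γ(X.left, V)) :
    ∑ L, c L • tensorSection s ((hodgeSheaf X j).presheaf.map k.op (basisSection w L)) =
      tensorSection s (∑ L, c L • (hodgeSheaf X j).presheaf.map k.op (basisSection w L)) := by
  induction (Finset.univ : Finset K) using Finset.induction_on with
  | empty =>
    rw [Finset.sum_empty, Finset.sum_empty, tensorSection, ]
    refine hom_ext_of_appLE fun V' l μ => ?_
    rw [appLE_zero, appLE_comp, appLE_smulSection, map_zero, smul_zero]
  | insert L t hL ih =>
    rw [Finset.sum_insert hL, Finset.sum_insert hL, ih, tensorSection_add_right, tensorSection_smul_right]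

/-- `Σ_i T_{il} (e_i| ⊗ ω) = (Σ_i T_{il} e_i|) ⊗ ω`. [cite: Kodaira2005, §3.2 (c)] -/
lemma sum_smul_tensorSection_left (k : V ⟶ W) (e : SheafOfModules.free I ≅ E.over W) (ω : Γ(hodgeSheaf X j, V))
    (c : I → Γ(X.left, V)) :
    ∑ i, c i • tensorSection (E.presheaf.map k.op (basisSection e i)) ω =
      tensorSection (∑ i, c i • E.presheaf.map k.op (basisSection e i)) ω := by
  induction (Finset.univ : Finset I) using Finset.induction_on with
  | empty =>
    rw [Finset.sum_empty, Finset.sum_empty, tensorSection]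
    have h : evalAt (M := unitModule X.left) (E := E) (0 : Γ(E, V)) = 0 := by
      have h2 := evalAt_add (M := unitModule X.left) (E := E) (0 : Γ(E, V)) 0
      rw [add_zero] at h2
      exact left_eq_add.mp h2
    rw [h, zero_comp]
  | insert i t hi ih =>
    rw [Finset.sum_insert hi, Finset.sum_insert hi, ih, tensorSection_add_left, tensorSection_smul_left]

/-- **The transition matrix of the product frames is the Kronecker product**:
`T(e ⊗ w, e' ⊗ w')_{(i,K),(l,L)} = T(e, e')_{il} T(w, w')_{KL}`. [cite: Kodaira2005, §3.2 (c) (3.53)] -/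
theorem transition_twistFrame {W' : X.left.Opens} {I' K' : Type u} [Fintype I'] [Fintype K']
    (e : SheafOfModules.free I ≅ E.over W) (w : SheafOfModules.free K ≅ (hodgeSheaf X j).over W)
    (e' : SheafOfModules.free I' ≅ E.over W') (w' : SheafOfModules.free K' ≅ (hodgeSheaf X j).over W')
    (k : V ⟶ W) (k' : V ⟶ W') (ik : I × K) (lL : I' × K') :
    transition (twistFrame e w) (twistFrame e' w') k k' ik lL =
      transition e e' k k' ik.1 lL.1 * transition w w' k k' ik.2 lL.2 := by
  rw [transition_apply, basisSection_twistFrame]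
  change coord (twistFrame e w) k ((restrictHom k' (twistBasis e' w' lL) :
    (dual E).over V ⟶ (hodgeSheaf X j).over V) : Γ(sheafHom (dual E) (hodgeSheaf X j), V)) ik = _
  rw [coord_twistFrame, map_dualBasisSection, appLE_restrictHom, Category.id_comp, appLE_twistBasis,
    coord_smul, coord_dualFrame, ← transition_apply w w' k k']
  congr 1
  change appLE (dualBasis (SheafOfModules.restrictTrivialisation (R := X.left.ringCatSheaf) k e) ik.1) (𝟙 V)
    (E.presheaf.map k'.op (basisSection e' lL.1)) = _
  rw [← restrictHom_dualBasis, appLE_restrictHom, Category.id_comp, ← coord_def, transition_apply]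

end SimpleTensor

/-! ### The frame splitting of the `Ωʲ`-twisted jet sequence -/

section FrameSplitting

variable (e : SheafOfModules.free I ≅ E.over W) (w : SheafOfModules.free K ≅ (hodgeSheaf X j).over W)
  [Fintype I] [Fintype K]

/-- **The section of the `Ωʲ`-twisted jet sequence defined by a bi-frame** (trivial connection of the
frame `e`, composed with `∧`, coefficients read in the coframe `w`): the `𝒪`-linear map
`(E ⊗ Ωʲ)|_W → Pʲ(E)|_W` with `e_i ⊗ ω_K ↦ (e_i ⊗ ω_K, 0)`, defined by freeness of `(E ⊗ Ωʲ)|_W` on the product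
basis. [cite: BuchweitzFlenner2003, Def. 3.4] [cite: Atiyah1957, §4] -/
def frameTwistJetSection : (twistHodge E j).over W ⟶ (twistJetModule E j).over W :=
  (twistFrame e w).inv ≫ ((twistJetModule E j).over W).freeHomEquiv.symm fun ik =>
    (Scheme.Modules.overSectionsEquiv (twistJetModule E j) W).symm
      (TwistJetSections.mk (twistBasis e w ik) 0 : TwistJetSections E j W)

/-- On the product basis: `s(e_i ⊗ ω_K) = (e_i ⊗ ω_K, 0)`. [cite: Atiyah1957, §4] -/
theorem appLE_frameTwistJetSection_basisSection (ik : I × K) :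
    appLE (frameTwistJetSection E j e w) (𝟙 W) (basisSection (twistFrame e w) ik) =
      (TwistJetSections.mk (twistBasis e w ik) 0 : TwistJetSections E j W) := by
  rw [appLE_basisSection_eq, frameTwistJetSection, Iso.hom_inv_id_assoc, Equiv.apply_symm_apply,
    Equiv.apply_symm_apply]

/-- Restricted product basis sections: `s((e_i ⊗ ω_K)|_V) = ((e_i ⊗ ω_K)|_V, 0)`. [cite: Atiyah1957, §4] -/
theorem appLE_frameTwistJetSection_map_basisSection (k : V ⟶ W) (ik : I × K) :
    appLE (frameTwistJetSection E j e w) k ((twistHodge E j).presheaf.map k.op (basisSection (twistFrame e w) ik)) =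
      (TwistJetSections.mk (restrictHom k (twistBasis e w ik)) 0 : TwistJetSections E j V) := by
  have h := appLE_map (frameTwistJetSection E j e w) (𝟙 W) k (basisSection (twistFrame e w) ik)
  rw [Category.comp_id] at h
  rw [h, appLE_frameTwistJetSection_basisSection]
  exact TwistJetSections.ext rfl (restrictHom_zero k)

omit [Fintype I] [Fintype K] in
/-- First components of a finite sum of twisted jet sections. [cite: Atiyah1957, §4] -/
lemma TwistJetSections.fst_sum {ι' : Type*} (t : Finset ι') (q : ι' → TwistJetSections E j V) :
    TwistJetSections.fst (∑ i ∈ t, q i) = ∑ i ∈ t, TwistJetSections.fst (q i) :=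
  map_sum (⟨⟨TwistJetSections.fst, TwistJetSections.fst_zero⟩, TwistJetSections.fst_add⟩ :
    TwistJetSections E j V →+ ((dual E).over V ⟶ (hodgeSheaf X j).over V)) q t

omit [Fintype I] [Fintype K] in
/-- Second components of a finite sum of twisted jet sections. [cite: Atiyah1957, §4] -/
lemma TwistJetSections.snd_sum {ι' : Type*} (t : Finset ι') (q : ι' → TwistJetSections E j V) :
    TwistJetSections.snd (∑ i ∈ t, q i) = ∑ i ∈ t, TwistJetSections.snd (q i) :=
  map_sum (⟨⟨TwistJetSections.snd, TwistJetSections.snd_zero⟩, TwistJetSections.snd_add⟩ :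
    TwistJetSections E j V →+ ((dual E).over V ⟶ (hodgeSheaf X (j + 1)).over V)) q t

/-- **Values of the bi-frame section**: for `φ = Σ_{iK} f_{iK} (e_i ⊗ ω_K)|` over `V ≤ W` (coordinates
`f_{iK} = λ^w_K(φ(λ^e_i))`), `s(φ) = (φ, Σ_{iK} df_{iK} ∧ (e_i ⊗ ω_K)|)` — the twisted module law
`f • (b, 0) = (f b, df ∧ b)`: `d` acts on the coefficient functions only. [cite: BuchweitzFlenner2003, Def. 3.4]
[cite: Atiyah1957, §4 (p. 193)] -/
theorem appLE_frameTwistJetSection (k : V ⟶ W) (φ : Γ(twistHodge E j, V)) :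
    appLE (frameTwistJetSection E j e w) k φ =
      (TwistJetSections.mk (φ : (dual E).over V ⟶ (hodgeSheaf X j).over V)
        (∑ ik, wedgeD E j V (coord (twistFrame e w) k φ ik) (restrictHom k (twistBasis e w ik))) :
        TwistJetSections E j V) := by
  rw [appLE_eq_sum_coord (twistFrame e w) (frameTwistJetSection E j e w) k φ]
  simp_rw [appLE_frameTwistJetSection_map_basisSection]
  refine TwistJetSections.ext ?_ ?_
  · change TwistJetSections.fst (∑ ik, coord (twistFrame e w) k φ ik •
      (TwistJetSections.mk (restrictHom k (twistBasis e w ik)) 0 : TwistJetSections E j V)) = _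
    rw [TwistJetSections.fst_sum, TwistJetSections.fst_mk]
    simp_rw [TwistJetSections.fst_smul, TwistJetSections.fst_mk]
    conv_rhs => rw [eq_sum_coord_smul (twistFrame e w) k φ]
    refine Finset.sum_congr rfl fun ik _ => ?_
    rw [basisSection_twistFrame]
    rfl
  · change TwistJetSections.snd (∑ ik, coord (twistFrame e w) k φ ik •
      (TwistJetSections.mk (restrictHom k (twistBasis e w ik)) 0 : TwistJetSections E j V)) = _
    rw [TwistJetSections.snd_sum, TwistJetSections.snd_mk]
    simp_rw [TwistJetSections.snd_smul, TwistJetSections.snd_mk, TwistJetSections.fst_mk, smul_zero, zero_add]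

/-- `s` is a section of `Pʲ(E) → E ⊗ Ωʲ` over `W`. [cite: Atiyah1957, §4] -/
theorem frameTwistJetSection_comp_π :
    frameTwistJetSection E j e w ≫ (SheafOfModules.overFunctor _ W).map (twistJetπ E j) =
      𝟙 ((twistHodge E j).over W) := by
  refine hom_ext_of_appLE fun V k φ => ?_
  rw [appLE_comp, appLE_over_map, appLE_id, appLE_frameTwistJetSection]
  rfl

/-- **The splitting of the `Ωʲ`-twisted jet sequence over `W` defined by the bi-frame `(e, w)`.**
[cite: Atiyah1957, §4] [cite: BuchweitzFlenner2003, Def. 3.4] -/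
def frameTwistJetSplitting : ((twistJetShortComplex E j).map (Scheme.Modules.overFunctor W)).Splitting :=
  Cech.localSplittingOfSection (twistJetShortComplex_shortExact E j) W (frameTwistJetSection E j e w)
    (by exact frameTwistJetSection_comp_π E j e w)

/-- The section of the bi-frame splitting is `s`. [cite: Atiyah1957, §4] -/
@[simp] lemma frameTwistJetSplitting_s : (frameTwistJetSplitting E j e w).s = frameTwistJetSection E j e w := rfl

/-- **The retraction of the bi-frame splitting** `Pʲ(E)|_W → (E ⊗ Ωʲ⁺¹)|_W`. [cite: Atiyah1957, §4] -/
def frameTwistJetRetraction : (twistJetModule E j).over W ⟶ (twistHodge E (j + 1)).over W :=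
  (frameTwistJetSplitting E j e w).r

/-- `r ≫ ι = 𝟙 - π ≫ s` (Mathlib `Splitting.r_f`). [cite: Atiyah1957, §4] -/
lemma frameTwistJetRetraction_comp_ι :
    frameTwistJetRetraction E j e w ≫ (SheafOfModules.overFunctor _ W).map (twistJetι E j) =
      𝟙 ((twistJetModule E j).over W) -
        (SheafOfModules.overFunctor _ W).map (twistJetπ E j) ≫ frameTwistJetSection E j e w :=
  (frameTwistJetSplitting E j e w).r_f

/-- **Values of the retraction**: `r(φ, ψ) = ψ - Σ_{iK} df_{iK} ∧ (e_i ⊗ ω_K)|`, `f_{iK}` the coordinates of `φ`.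
[cite: Atiyah1957, §4] -/
theorem appLE_frameTwistJetRetraction (k : V ⟶ W) (p : Γ(twistJetModule E j, V)) :
    appLE (frameTwistJetRetraction E j e w) k p =
      TwistJetSections.snd (p : TwistJetSections E j V) -
        ∑ ik, wedgeD E j V (coord (twistFrame e w) k
            ((TwistJetSections.fst (p : TwistJetSections E j V) : (dual E).over V ⟶ (hodgeSheaf X j).over V) :
              Γ(twistHodge E j, V)) ik) (restrictHom k (twistBasis e w ik)) := by
  have h' := congrArg (fun φ => appLE φ k p) (frameTwistJetRetraction_comp_ι E j e w)
  simp only [appLE_comp, appLE_over_map, appLE_sub', appLE_id, twistJetι_app_apply, twistJetπ_app_apply,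
    appLE_frameTwistJetSection] at h'
  have := congrArg TwistJetSections.snd h'
  rw [TwistJetSections.snd_mk] at this
  rw [this]
  rfl

end FrameSplitting

/-! ### Bi-framings and the level-`j` Atiyah cocycle -/

section BiFraming

variable {E j}

/-- **A bi-framing** of `E` and of a second module `G` (here `G = Ωʲ`) on a common family of opens: opens `U_a`,
finite index types, and frames `e_a : 𝒪^{I_a} ≅ E|_{U_a}`, `w_a : 𝒪^{K_a} ≅ G|_{U_a}`.
[cite: Kodaira2005, §3.2 (c)] -/
structure BiFraming (E G : X.left.Modules) (ι : Type u) where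
  /-- The open `U_a`. -/
  U : ι → X.left.Opens
  /-- The index type of the frame of `E` over `U_a`. -/
  I : ι → Type u
  /-- The index type of the frame of `G` over `U_a`. -/
  K : ι → Type u
  /-- The index types are finite. -/
  [instFintypeI : ∀ a, Fintype (I a)]
  /-- The index types are finite. -/
  [instFintypeK : ∀ a, Fintype (K a)]
  /-- The frame `e_a : 𝒪^{I_a} ≅ E|_{U_a}`. -/
  e : ∀ a, SheafOfModules.free (I a) ≅ E.over (U a)
  /-- The frame `w_a : 𝒪^{K_a} ≅ G|_{U_a}`. -/
  w : ∀ a, SheafOfModules.free (K a) ≅ G.over (U a)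

attribute [instance] BiFraming.instFintypeI BiFraming.instFintypeK

namespace BiFraming

variable {G : X.left.Modules}

/-- **Finite locally free `E` and `G` admit a bi-framing indexed by the points of `X`**: intersect the
trivialising neighbourhoods and restrict the chosen frames. [cite: Kodaira2005, §3.2 (c)] -/
def ofIsFiniteLocallyFree (hE : IsFiniteLocallyFree E) (hG : IsFiniteLocallyFree G) :
    BiFraming E G X.left where
  U x := trivNbhd hE x ⊓ trivNbhd hG x
  I x := TrivIndex hE x
  K x := TrivIndex hG x
  e x := SheafOfModules.restrictTrivialisation (R := X.left.ringCatSheaf) (homOfLE inf_le_left) (trivFrame hE x)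
  w x := SheafOfModules.restrictTrivialisation (R := X.left.ringCatSheaf) (homOfLE inf_le_right) (trivFrame hG x)

/-- The bi-framing of finite locally free `E`, `G` covers `X`. [cite: Kodaira2005, §3.2 (c)] -/
theorem iSup_U_ofIsFiniteLocallyFree (hE : IsFiniteLocallyFree E) (hG : IsFiniteLocallyFree G) :
    iSup (ofIsFiniteLocallyFree hE hG).U = ⊤ :=
  top_le_iff.mp fun x _ => Opens.mem_iSup.2 ⟨x, mem_trivNbhd hE x, mem_trivNbhd hG x⟩

/-- The framing of `E` underlying a bi-framing. [cite: Kodaira2005, §3.2 (c)] -/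
def toFraming {ι : Type u} (𝔣 : BiFraming E G ι) : Framing E ι where
  U := 𝔣.U
  I := 𝔣.I
  e := 𝔣.e

end BiFraming

variable {ι : Type u} (𝔣 : BiFraming E (hodgeSheaf X j) ι)

variable (E j) in
/-- The local splittings of the `Ωʲ`-twisted jet sequence given by a bi-framing. [cite: Atiyah1957, §4] -/
def frameTwistJetSplittings : Cech.LocalSplittings 𝔣.U (twistJetShortComplex E j) := fun a =>
  frameTwistJetSplitting E j (𝔣.e a) (𝔣.w a)

variable (E j) in
/-- **The level-`j` Atiyah cocycle of a bi-framing**: the difference cocycle `s_a ≫ r_b` of the bi-frame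
splittings of the `Ωʲ`-twisted jet sequence, a Čech `1`-cocycle of local homomorphisms
`(E ⊗ Ωʲ)|_{U_a ∩ U_b} → (E ⊗ Ωʲ⁺¹)|_{U_a ∩ U_b}`. [cite: Atiyah1957, §4] [cite: BuchweitzFlenner2003, Def. 3.4] -/
def atiyahStepCocycle : Cech.LocalFamily 𝔣.U 1 (twistHodge E j) (twistHodge E (j + 1)) :=
  Cech.splittingDifference (frameTwistJetSplittings E j 𝔣)

/-- The level-`j` Atiyah cocycle is a cocycle. [cite: Atiyah1957, §4] -/
theorem dFamily_atiyahStepCocycle : Cech.dFamily (atiyahStepCocycle E j 𝔣) = 0 :=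
  Cech.dFamily_splittingDifference _

/-- Unfolding the cocycle: `a_{ab}(φ) = r_b(s_a(φ))`. [cite: Atiyah1957, §4] -/
theorem appLE_atiyahStepCocycle_eq (β : Fin 2 → ι) (k : V ⟶ face 𝔣.U β) (φ : Γ(twistHodge E j, V)) :
    appLE (atiyahStepCocycle E j 𝔣 β) k φ =
      appLE (frameTwistJetRetraction E j (𝔣.e (β 1)) (𝔣.w (β 1))) (k ≫ homOfLE (face_le 𝔣.U β 1))
        (appLE (frameTwistJetSection E j (𝔣.e (β 0)) (𝔣.w (β 0))) (k ≫ homOfLE (face_le 𝔣.U β 0)) φ) := rfl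

/-- **Values of the level-`j` Atiyah cocycle**: for `φ ∈ Γ(E ⊗ Ωʲ, V)`, `V ≤ U_a ∩ U_b`,
`a_{ab}(φ) = Σ_{iK} df^a_{iK} ∧ b^a_{iK}| - Σ_{lL} df^b_{lL} ∧ b^b_{lL}|` (difference of the trivial connections
of the two bi-frames). [cite: Atiyah1957, §4] [cite: BuchweitzFlenner2003, Def. 3.4] -/
theorem appLE_atiyahStepCocycle (β : Fin 2 → ι) (k : V ⟶ face 𝔣.U β) (φ : Γ(twistHodge E j, V)) :
    appLE (atiyahStepCocycle E j 𝔣 β) k φ =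
      ∑ ik, wedgeD E j V (coord (twistFrame (𝔣.e (β 0)) (𝔣.w (β 0))) (k ≫ homOfLE (face_le 𝔣.U β 0)) φ ik)
          (restrictHom (k ≫ homOfLE (face_le 𝔣.U β 0)) (twistBasis (𝔣.e (β 0)) (𝔣.w (β 0)) ik)) -
        ∑ lL, wedgeD E j V (coord (twistFrame (𝔣.e (β 1)) (𝔣.w (β 1))) (k ≫ homOfLE (face_le 𝔣.U β 1)) φ lL)
          (restrictHom (k ≫ homOfLE (face_le 𝔣.U β 1)) (twistBasis (𝔣.e (β 1)) (𝔣.w (β 1)) lL)) := by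
  rw [appLE_atiyahStepCocycle_eq, appLE_frameTwistJetRetraction, appLE_frameTwistJetSection,
    TwistJetSections.snd_mk, TwistJetSections.fst_mk]

/-- **The level-`j` Atiyah cocycle on basis sections: `dT^{⊗}_{ab}` read in the bi-frame `a`.** For the
`(l,L)`-th product basis section of `(e_b, w_b)` restricted to `V ≤ U_a ∩ U_b`,
`a_{ab}(b^b_{lL}) = Σ_{iK} d(T^{⊗}_{ab})_{(iK),(lL)} ∧ b^a_{iK}|`, `T^{⊗}_{ab}` the transition matrix of the product
frames (the Kronecker product `T(e_a,e_b) ⊗ T(w_a,w_b)`, `transition_twistFrame`).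
[cite: Atiyah1957, §4 Prop. 12] [cite: Kodaira2005, §3.2 (c) (3.53)] -/
theorem appLE_atiyahStepCocycle_basisSection (β : Fin 2 → ι) (k : V ⟶ face 𝔣.U β)
    (lL : 𝔣.I (β 1) × 𝔣.K (β 1)) :
    appLE (atiyahStepCocycle E j 𝔣 β) k ((twistHodge E j).presheaf.map (k ≫ homOfLE (face_le 𝔣.U β 1)).op
        (basisSection (twistFrame (𝔣.e (β 1)) (𝔣.w (β 1))) lL)) =
      ∑ ik, wedgeD E j V
        (transition (twistFrame (𝔣.e (β 0)) (𝔣.w (β 0))) (twistFrame (𝔣.e (β 1)) (𝔣.w (β 1)))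
          (k ≫ homOfLE (face_le 𝔣.U β 0)) (k ≫ homOfLE (face_le 𝔣.U β 1)) ik lL)
        (restrictHom (k ≫ homOfLE (face_le 𝔣.U β 0)) (twistBasis (𝔣.e (β 0)) (𝔣.w (β 0)) ik)) := by
  rw [appLE_atiyahStepCocycle]
  have hb : ∑ lL', wedgeD E j V (coord (twistFrame (𝔣.e (β 1)) (𝔣.w (β 1))) (k ≫ homOfLE (face_le 𝔣.U β 1))
      ((twistHodge E j).presheaf.map (k ≫ homOfLE (face_le 𝔣.U β 1)).op
        (basisSection (twistFrame (𝔣.e (β 1)) (𝔣.w (β 1))) lL)) lL')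
      (restrictHom (k ≫ homOfLE (face_le 𝔣.U β 1)) (twistBasis (𝔣.e (β 1)) (𝔣.w (β 1)) lL')) = 0 := by
    refine Finset.sum_eq_zero fun lL' _ => ?_
    rw [coord_map_basisSection]
    split_ifs
    · exact wedgeD_one E j _
    · exact wedgeD_zero_left E j _
  rw [hb, sub_zero]
  rfl

/-- **Two-term formula.** On the product basis section `e^b_l ⊗ ω^b_L` the level-`j` Atiyah cocycle is
`Σ_i dT_{il} ∧ (e^a_i ⊗ ω^b_L) + Σ_K dR_{KL} ∧ (e^b_l ⊗ ω^a_K)` with `T = T(e_a, e_b)`, `R = T(w_a, w_b)`: the Atiyah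
cocycle `{dT}` of `E` (`AtiyahClassCech.appLE_atiyahCocycle_basisSection`) wedged on the form part, plus `1_E ⊗`
the cocycle of `Pʲ(𝒪_X)` in the coframes. [cite: Atiyah1957, §4 Prop. 10, Prop. 12]
[cite: Kodaira2005, §3.2 (c) (3.53)] -/
theorem appLE_atiyahStepCocycle_basisSection_eq_add (β : Fin 2 → ι) (k : V ⟶ face 𝔣.U β)
    (l : 𝔣.I (β 1)) (L : 𝔣.K (β 1)) :
    appLE (atiyahStepCocycle E j 𝔣 β) k ((twistHodge E j).presheaf.map (k ≫ homOfLE (face_le 𝔣.U β 1)).op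
        (basisSection (twistFrame (𝔣.e (β 1)) (𝔣.w (β 1))) (l, L))) =
      ∑ i, wedgeD E j V
          (transition (𝔣.e (β 0)) (𝔣.e (β 1)) (k ≫ homOfLE (face_le 𝔣.U β 0)) (k ≫ homOfLE (face_le 𝔣.U β 1)) i l)
          (tensorSection (E.presheaf.map (k ≫ homOfLE (face_le 𝔣.U β 0)).op (basisSection (𝔣.e (β 0)) i))
            ((hodgeSheaf X j).presheaf.map (k ≫ homOfLE (face_le 𝔣.U β 1)).op (basisSection (𝔣.w (β 1)) L))) +
        ∑ K', wedgeD E j V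
          (transition (𝔣.w (β 0)) (𝔣.w (β 1)) (k ≫ homOfLE (face_le 𝔣.U β 0)) (k ≫ homOfLE (face_le 𝔣.U β 1)) K' L)
          (tensorSection (E.presheaf.map (k ≫ homOfLE (face_le 𝔣.U β 1)).op (basisSection (𝔣.e (β 1)) l))
            ((hodgeSheaf X j).presheaf.map (k ≫ homOfLE (face_le 𝔣.U β 0)).op (basisSection (𝔣.w (β 0)) K'))) := by
  rw [appLE_atiyahStepCocycle_basisSection]
  -- abbreviations
  set k₀ := k ≫ homOfLE (face_le 𝔣.U β 0)
  set k₁ := k ≫ homOfLE (face_le 𝔣.U β 1)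
  set T := transition (𝔣.e (β 0)) (𝔣.e (β 1)) k₀ k₁ with hT
  set R := transition (𝔣.w (β 0)) (𝔣.w (β 1)) k₀ k₁ with hR
  have hb : ∀ ik : 𝔣.I (β 0) × 𝔣.K (β 0), restrictHom k₀ (twistBasis (𝔣.e (β 0)) (𝔣.w (β 0)) ik) =
      tensorSection (E.presheaf.map k₀.op (basisSection (𝔣.e (β 0)) ik.1))
        ((hodgeSheaf X j).presheaf.map k₀.op (basisSection (𝔣.w (β 0)) ik.2)) := fun ik => by
    rw [← tensorSection_basisSection, restrictHom_tensorSection]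
  simp_rw [transition_twistFrame, hb, wedgeD_mul]
  rw [Finset.sum_add_distrib, Fintype.sum_prod_type, Fintype.sum_prod_type]
  refine (congrArg₂ (· + ·) ?_ ?_).trans (add_comm _ _)
  · -- `Σ_i Σ_K T_{il} • (dR_{KL} ∧ (e_i ⊗ ω_K)) = Σ_K dR_{KL} ∧ (e^b_l ⊗ ω_K)`
    rw [Finset.sum_comm]
    refine Finset.sum_congr rfl fun K' _ => ?_
    simp_rw [← wedgeD_smul_right]
    rw [← wedgeD_sum_right, sum_smul_tensorSection_left, ← map_basisSection_eq_sum_transition]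
  · -- `Σ_i Σ_K R_{KL} • (dT_{il} ∧ (e_i ⊗ ω_K)) = Σ_i dT_{il} ∧ (e_i ⊗ ω^b_L)`
    refine Finset.sum_congr rfl fun i _ => ?_
    simp_rw [← wedgeD_smul_right]
    rw [← wedgeD_sum_right, sum_smul_tensorSection_right, ← map_basisSection_eq_sum_transition]

/-! ### Global coframes: the level-`j` cocycle is the Atiyah cocycle of `E` wedged on the form part -/

/-- Two restrictions of one frame have identity transition matrix. [cite: Kodaira2005, §3.2 (c) (3.53)] -/
lemma transition_restrictTrivialisation_self {G : X.left.Modules} {Y W' : X.left.Opens} [Fintype K]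
    (w : SheafOfModules.free K ≅ G.over Y) (ka : W ⟶ Y) (kb : W' ⟶ Y) (k : V ⟶ W) (k' : V ⟶ W') :
    transition (SheafOfModules.restrictTrivialisation (R := X.left.ringCatSheaf) ka w)
      (SheafOfModules.restrictTrivialisation (R := X.left.ringCatSheaf) kb w) k k' = 1 := by
  ext K₁ K₂
  rw [transition_apply, basisSection_restrictTrivialisation, presheaf_map_map, coord_def, ← restrictHom_dualBasis,
    appLE_restrictHom, ← coord_def, Subsingleton.elim (k' ≫ kb) (k ≫ ka), coord_map_basisSection, Matrix.one_apply]
  exact if_congr eq_comm rfl rfl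

/-- **A framing of `E` and ONE frame `w` of `Ωʲ` over an open `Y` containing the cover** (e.g. a global coframe of
an abelian scheme) give a bi-framing with all coframes `w|_{U_a}`. [cite: Kodaira2005, §3.2 (c)] -/
def BiFraming.ofFraming (𝔢 : Framing E ι) {Y : X.left.Opens} {K : Type u} [Fintype K]
    (w : SheafOfModules.free K ≅ (hodgeSheaf X j).over Y) (hU : ∀ a, 𝔢.U a ≤ Y) :
    BiFraming E (hodgeSheaf X j) ι where
  U := 𝔢.U
  I := 𝔢.I
  K _ := K
  e := 𝔢.e
  w a := SheafOfModules.restrictTrivialisation (R := X.left.ringCatSheaf) (homOfLE (hU a)) w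

/-- **With a common coframe the coframe term vanishes**: for the bi-framing `𝔣 = (𝔢, w|_{U_a})` the level-`j`
Atiyah cocycle on `e^b_l ⊗ ω_L` is `Σ_i dT_{il} ∧ (e^a_i ⊗ ω_L)` — the Atiyah cocycle `{dT_{ab}}` of `E`
(`AtiyahClassCech.appLE_atiyahCocycle_basisSection`) wedged on the form part, with NO second term (`R_{ab} = 1`).
[cite: Atiyah1957, §4 Prop. 12] [cite: BuchweitzFlenner2003, Def. 3.4] -/
theorem appLE_atiyahStepCocycle_basisSection_ofFraming (𝔢 : Framing E ι) {Y : X.left.Opens} [Fintype K]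
    (w : SheafOfModules.free K ≅ (hodgeSheaf X j).over Y) (hU : ∀ a, 𝔢.U a ≤ Y)
    (β : Fin 2 → ι) (k : V ⟶ face (BiFraming.ofFraming (j := j) 𝔢 w hU).U β)
    (l : (BiFraming.ofFraming (j := j) 𝔢 w hU).I (β 1)) (L : K) :
    appLE (atiyahStepCocycle E j (BiFraming.ofFraming 𝔢 w hU) β) k
        ((twistHodge E j).presheaf.map (k ≫ homOfLE (face_le (BiFraming.ofFraming (j := j) 𝔢 w hU).U β 1)).op
          (basisSection (twistFrame ((BiFraming.ofFraming (j := j) 𝔢 w hU).e (β 1))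
            ((BiFraming.ofFraming (j := j) 𝔢 w hU).w (β 1))) (l, L))) =
      ∑ i, wedgeD E j V
        (transition ((BiFraming.ofFraming (j := j) 𝔢 w hU).e (β 0)) ((BiFraming.ofFraming (j := j) 𝔢 w hU).e (β 1))
          (k ≫ homOfLE (face_le (BiFraming.ofFraming (j := j) 𝔢 w hU).U β 0))
          (k ≫ homOfLE (face_le (BiFraming.ofFraming (j := j) 𝔢 w hU).U β 1)) i l)
        (tensorSection
          (E.presheaf.map (k ≫ homOfLE (face_le (BiFraming.ofFraming (j := j) 𝔢 w hU).U β 0)).op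
            (basisSection ((BiFraming.ofFraming (j := j) 𝔢 w hU).e (β 0)) i))
          ((hodgeSheaf X j).presheaf.map
            (k ≫ homOfLE ((face_le (BiFraming.ofFraming (j := j) 𝔢 w hU).U β 1).trans (hU (β 1)))).op
            (basisSection w L))) := by
  rw [appLE_atiyahStepCocycle_basisSection_eq_add]
  have h2 : ∀ K', wedgeD E j V (transition ((BiFraming.ofFraming (j := j) 𝔢 w hU).w (β 0))
      ((BiFraming.ofFraming (j := j) 𝔢 w hU).w (β 1))
      (k ≫ homOfLE (face_le (BiFraming.ofFraming (j := j) 𝔢 w hU).U β 0))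
      (k ≫ homOfLE (face_le (BiFraming.ofFraming (j := j) 𝔢 w hU).U β 1)) K' L)
      (tensorSection
        (E.presheaf.map (k ≫ homOfLE (face_le (BiFraming.ofFraming (j := j) 𝔢 w hU).U β 1)).op
          (basisSection ((BiFraming.ofFraming (j := j) 𝔢 w hU).e (β 1)) l))
        ((hodgeSheaf X j).presheaf.map (k ≫ homOfLE (face_le (BiFraming.ofFraming (j := j) 𝔢 w hU).U β 0)).op
          (basisSection ((BiFraming.ofFraming (j := j) 𝔢 w hU).w (β 0)) K'))) = 0 := by
    intro K'
    change wedgeD E j V (transition (SheafOfModules.restrictTrivialisation (R := X.left.ringCatSheaf) _ w)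
      (SheafOfModules.restrictTrivialisation (R := X.left.ringCatSheaf) _ w) _ _ K' L) _ = 0
    rw [transition_restrictTrivialisation_self, Matrix.one_apply]
    split_ifs
    · exact wedgeD_one E j _
    · exact wedgeD_zero_left E j _
  rw [Finset.sum_eq_zero fun K' _ => h2 K', add_zero]
  refine Finset.sum_congr rfl fun i _ => ?_
  change wedgeD E j V _ (tensorSection _ ((hodgeSheaf X j).presheaf.map _
    (basisSection (SheafOfModules.restrictTrivialisation (R := X.left.ringCatSheaf) _ w) L))) = _
  rw [basisSection_restrictTrivialisation, presheaf_map_map,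
    Subsingleton.elim ((k ≫ homOfLE (face_le (BiFraming.ofFraming (j := j) 𝔢 w hU).U β 1)) ≫ homOfLE (hU (β 1)))
      (k ≫ homOfLE ((face_le (BiFraming.ofFraming (j := j) 𝔢 w hU).U β 1).trans (hU (β 1))))]

variable [HasExt.{u + 1} X.left.Modules]

variable (E j) in
/-- **The `j`-th Atiyah step is the Čech class of the level-`j` Atiyah cocycle of any bi-framing**, for any
exact augmentation of the Čech complex of `E ⊗ Ωʲ⁺¹` by `Cech.augment` (e.g. the Čech resolution of the cover).
[cite: BuchweitzFlenner2003, Def. 3.4, Thm. 3.10] [cite: Hartshorne1977, III.4] -/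
theorem atiyahClassStep_eq_classOf
    (a : ExactAugmentation (Cech.complex 𝔣.U (twistHodge E (j + 1))) (twistHodge E (j + 1)))
    (ha : a.ε = Cech.augment 𝔣.U (twistHodge E (j + 1))) :
    atiyahClassStep E j = Cech.classOf a (atiyahStepCocycle E j 𝔣) (dFamily_atiyahStepCocycle 𝔣) :=
  (Cech.classOf_splittingDifference (frameTwistJetSplittings E j 𝔣) (twistJetShortComplex_shortExact E j)
    a ha).symm

variable (E j) in
/-- The same for the Čech resolution of a bi-framing by a cover. [cite: BuchweitzFlenner2003, Def. 3.4, Thm. 3.10]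
[cite: Hartshorne1977, III.4] -/
theorem atiyahClassStep_eq_classOf_exactAugmentation (hU : iSup 𝔣.U = ⊤) :
    atiyahClassStep E j =
      Cech.classOf (Cech.exactAugmentation 𝔣.U (twistHodge E (j + 1)) hU) (atiyahStepCocycle E j 𝔣)
        (dFamily_atiyahStepCocycle 𝔣) :=
  atiyahClassStep_eq_classOf E j 𝔣 _ (Cech.exactAugmentation_ε _ _ hU)

/-- **For `E` and `Ωʲ` finite locally free, `at_j(E)` is the Čech class of the cocycle of the canonical
bi-framing by points.** [cite: BuchweitzFlenner2003, Thm. 3.10] -/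
theorem atiyahClassStep_eq_classOf_ofIsFiniteLocallyFree (hE : IsFiniteLocallyFree E)
    (hΩ : IsFiniteLocallyFree (hodgeSheaf X j)) :
    atiyahClassStep E j =
      Cech.classOf (Cech.exactAugmentation _ (twistHodge E (j + 1))
          (BiFraming.iSup_U_ofIsFiniteLocallyFree hE hΩ))
        (atiyahStepCocycle E j (BiFraming.ofIsFiniteLocallyFree hE hΩ))
        (dFamily_atiyahStepCocycle _) :=
  atiyahClassStep_eq_classOf_exactAugmentation E j _ _

end BiFraming

end Literature.AlgebraicGeometry.HodgeTheory

end
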